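import Summits.MatrixMultiplication.OmegaCensus.ThreeSetZ5Z5Cover6Defs
import HarnessLib

/-!
# ORDER-SPECIFIC (Farkas / LP) certificates for the three-set line identity

ω-census `pub-omega`, family (b3), seat pub-omega-group gen 36.  Framing: lottery ticket; floor = certified bounds/negative
ranges.  VALUE: the companion of `ThreeSetLineCertificate.no_line_identity3_of_certificate` for line data whose system
`Σ_u M(τ,u)·G(u) + [s = τ] = K` HAS integer solutions (no modular certificate) but no NON-NEGATIVE one at the fibre size `K` of
a given order `|A| = q·K`; NOT progress on ω.  Used for the four "centroid" configurations of the `(4,4,·)` cell over `ℤ₅²` at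
`|A| = 625` (`ThreeSetZ5Z5Cells44.lean`), which carry genuine `ℤ₅²`-local solutions from `|A| = 3025` on.

* **`no_line_identity3_of_lp_cert`** (generic `q`): if `z : ZMod q → ℤ` has `Σ_τ z(τ)·M(τ,u) ≥ 0` for every `u` and
  `K·Σz < z(s)`, then no `G ≥ 0` satisfies the identity (pair the identity with `z`: `K·Σz = Σ_u G(u)·(zᵀM)_u + z(s) ≥ z(s)`).
* `lpOKNat W F K z s` — the pure-`ℤ` list check (`q = 5`, matrix via `lineMat3Nat`) and its bridge `false_of_lpOKNat`.
-/

namespace Summit.MatrixMultiplication.OmegaCensus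

open Finset

section LP

variable {q : ℕ} [NeZero q]

/-- **No three-set line identity under an LP (Farkas) certificate at fibre size `K`.** [folklore] -/
theorem no_line_identity3_of_lp_cert (W F G : ZMod q → ℕ) (s : ZMod q) (K : ℕ)
    (hid : ∀ τ : ZMod q, (∑ u : ZMod q, lineMat3 W F τ u * G u) + (if s = τ then 1 else 0) = K)
    (z : ZMod q → ℤ) (hz : ∀ u : ZMod q, 0 ≤ ∑ τ : ZMod q, z τ * (lineMat3 W F τ u : ℤ))
    (hs : (K : ℤ) * ∑ τ : ZMod q, z τ < z s) : False := by
  have h1 : ∑ τ : ZMod q, z τ * (((∑ u : ZMod q, lineMat3 W F τ u * G u) + (if s = τ then 1 else 0) : ℕ) : ℤ) =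
      ∑ τ : ZMod q, z τ * (K : ℤ) := sum_congr rfl fun τ _ => by rw [hid τ]
  have h2 : ∑ τ : ZMod q, z τ * (((∑ u : ZMod q, lineMat3 W F τ u * G u) + (if s = τ then 1 else 0) : ℕ) : ℤ) =
      (∑ u : ZMod q, (G u : ℤ) * ∑ τ : ZMod q, z τ * (lineMat3 W F τ u : ℤ)) + z s := by
    have e : ∀ τ : ZMod q, z τ * (((∑ u : ZMod q, lineMat3 W F τ u * G u) + (if s = τ then 1 else 0) : ℕ) : ℤ) =
        (∑ u : ZMod q, z τ * ((lineMat3 W F τ u : ℤ) * (G u : ℤ))) + (if s = τ then z τ else 0) := by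
      intro τ
      push_cast
      rw [mul_add, mul_sum]
      congr 1
      split_ifs <;> simp
    rw [sum_congr rfl fun τ _ => e τ, sum_add_distrib, sum_ite_eq, if_pos (mem_univ _), sum_comm]
    congr 1
    refine sum_congr rfl fun u _ => ?_
    rw [mul_sum]
    exact sum_congr rfl fun τ _ => by ring
  have h3 : ∑ τ : ZMod q, z τ * (K : ℤ) = (K : ℤ) * ∑ τ : ZMod q, z τ := by rw [mul_sum]; exact sum_congr rfl fun τ _ => mul_comm _ _
  have h4 : 0 ≤ ∑ u : ZMod q, (G u : ℤ) * ∑ τ : ZMod q, z τ * (lineMat3 W F τ u : ℤ) :=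
    sum_nonneg fun u _ => mul_nonneg (by positivity) (hz u)
  rw [h2, h3] at h1
  linarith

/-- A sum over `ZMod 5` through `val` is a list sum over `range 5` (integer version of `sum_zmod5_val`). [folklore] -/
theorem sum_zmod5_val_int (g : ℕ → ℤ) : ∑ v : ZMod 5, g v.val = ((List.range 5).map g).sum := by
  have h : ((List.range 5).map g).sum = g 0 + g 1 + g 2 + g 3 + g 4 := by
    simp [List.range_succ, add_assoc]
  rw [h]
  exact Fin.sum_univ_five (fun v : Fin 5 => g v.val)

/-- **LP certificate check in pure `ℤ` list arithmetic** (`q = 5`): `z` of length `5`, `Σ_τ z(τ)·M(τ,u) ≥ 0` for all `u < 5`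
(matrix `lineMat3Nat`), and `K·Σz < z(s)`. [folklore] -/
def lpOKNat (W F : List ℕ) (K : ℕ) (z : List ℤ) (s : ℕ) : Bool :=
  (z.length == 5) && ((List.range 5).all fun u =>
    decide (0 ≤ ((List.range 5).map fun τ => z.getD τ 0 * (Z5Z5ThreeSet.lineMat3Nat W F τ u : ℤ)).sum)) &&
    decide ((K : ℤ) * z.sum < z.getD s 0)

/-- **Soundness of the list LP check**: no `G` satisfies the three-set line identity for `(vecFn W, vecFn F)` with hole value `s`
and fibre size `K`. [folklore] -/
theorem false_of_lpOKNat {W F : List ℕ} {K : ℕ} {z : List ℤ} {s : ℕ} (hs5 : s < 5) (h : lpOKNat W F K z s = true)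
    (G : ZMod 5 → ℕ)
    (hid : ∀ τ : ZMod 5, (∑ u : ZMod 5, lineMat3 (vecFn W) (vecFn F) τ u * G u) +
      (if ((s : ℕ) : ZMod 5) = τ then 1 else 0) = K) : False := by
  simp only [lpOKNat, Bool.and_eq_true, beq_iff_eq, List.all_eq_true, List.mem_range, decide_eq_true_eq] at h
  obtain ⟨⟨hlen, hz⟩, hlt⟩ := h
  refine no_line_identity3_of_lp_cert (vecFn W) (vecFn F) G ((s : ℕ) : ZMod 5) K hid (fun τ => z.getD τ.val 0)
    (fun u => ?_) ?_
  · have e : ∑ τ : ZMod 5, z.getD τ.val 0 * (lineMat3 (vecFn W) (vecFn F) τ u : ℤ) =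
        ((List.range 5).map fun τ => z.getD τ 0 * (Z5Z5ThreeSet.lineMat3Nat W F τ u.val : ℤ)).sum := by
      rw [← sum_zmod5_val_int (fun n => z.getD n 0 * (Z5Z5ThreeSet.lineMat3Nat W F n u.val : ℤ))]
      exact sum_congr rfl fun τ _ => by rw [Z5Z5ThreeSet.lineMat3_vecFn]
    rw [e]; exact hz u.val (ZMod.val_lt u)
  · have hsum : ∑ τ : ZMod 5, z.getD τ.val 0 = z.sum := by
      rw [sum_zmod5_val_int (fun n => z.getD n 0)]
      match z, hlen with
      | [a, b, c, d, e], _ => simp [List.range_succ]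
    rw [hsum, ZMod.val_natCast, Nat.mod_eq_of_lt hs5]
    exact hlt

end LP

end Summit.MatrixMultiplication.OmegaCensus
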